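import Literature.MathematicalPhysics.QuantumLattice.IsotropicPropagatorMoments
import HarnessLib

/-!
# Moment bounds of the anisotropic single-scale propagators (BGM 2006, (2.52a))

Topic `Literature/MathematicalPhysics/QuantumLattice`; a corollary of `SectorPropagatorDecay`
(Lemma 2.2 (2.52)). BGM 2006, Remark after Lemma 2.2: "The bound (2.52) implies that
`∫ dx |x|^j |g^{(h)}_ω(x)| ≤ C_j γ^{-(1+j)h}`, `j ≥ 0` (2.52a), that will be widely used in the
following." PROVED here for every `j` (sup norm on `ℝ × ℝ²`; the dominant directions `x₀, x'₁` have
range `γ^{-h} = 4ⁿ`, the tangential one only `2ⁿ`, so the anisotropic decay of our (2.52) gives the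
same exponent):

* `norm_le_mul_norm_sectorChartAdj` — `‖(x₀, x⃗)‖ ≤ 2π 4ⁿ ‖sectorChartAdj(ξ)‖` (`2^{-n} ≥ 4^{-n}`);
* **`sectorPropagator_moment`** — there is `C_j` with `|x|^j g ∈ L¹` and
  `∫ |x|^j ‖g^{(-n)}_ω(x)‖ dx ≤ C_j 4^{n(1+j)}` (`= C_j γ^{-(1+j)h}`) for all `n`, `0 ≤ ω < 2^{n+1}`.

Everything is PROVED; no new definitions.

## Sources

* G. Benfatto, A. Giuliani, V. Mastropietro, Ann. Henri Poincaré 7 (2006) 809–898, §2.5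
  Lemma 2.2 Remark, (2.52a) (arXiv:cond-mat/0507686 p. 10). [BenfattoGiulianiMastropietro2006]
-/

noncomputable section

open Real Set Complex Function Metric MeasureTheory MeasureTheory.Measure Module
open scoped Topology
open Literature.Analysis.Fourier

namespace Literature.MathematicalPhysics.QuantumLattice

section Moments

variable {μ : ℝ} (hμ₁ : -4 < μ) (hμ₂ : μ < -2 - Real.sqrt 2)
include hμ₁ hμ₂

/-- **`‖(x₀, x⃗)‖ ≤ 2π 4ⁿ ‖sectorChartAdj(ξ)‖`** (the tangential scale `2^{-n} ≥ 4^{-n}`). [folklore] -/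
theorem norm_le_mul_norm_sectorChartAdj (θ₀ : ℝ) (n : ℕ) (x₀ : ℝ) (x : Fin 2 → ℝ) :
    ‖((x₀, x) : ℝ × (Fin 2 → ℝ))‖ ≤ 2 * π * (4 : ℝ) ^ n * ‖sectorChartAdj μ θ₀ n (dualPoint x₀ x)‖ := by
  have h4 : 0 < (4 : ℝ) ^ (-(n : ℤ)) := zpow_pos (by norm_num) _
  have h2 : 0 < (2 : ℝ) ^ (-(n : ℤ)) := zpow_pos (by norm_num) _
  have h42 : (4 : ℝ) ^ (-(n : ℤ)) ≤ (2 : ℝ) ^ (-(n : ℤ)) := by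
    rw [four_zpow_neg_eq_sq, sq]
    exact mul_le_of_le_one_left h2.le (zpow_le_one_of_nonpos₀ (by norm_num) (by simp))
  -- compare with the isotropic adjoint: `‖isoChartAdj(ξ)‖ ≤ ‖sectorChartAdj(ξ)‖`
  have hle : ‖isoChartAdj μ θ₀ n (dualPoint x₀ x)‖ ≤ ‖sectorChartAdj μ θ₀ n (dualPoint x₀ x)‖ := by
    rw [EuclideanSpace.norm_eq, EuclideanSpace.norm_eq, Fin.sum_univ_three, Fin.sum_univ_three]
    refine Real.sqrt_le_sqrt ?_
    simp only [isoChartAdj, sectorChartAdj, PiLp.toLp_apply, Matrix.cons_val_zero, Matrix.cons_val_one, Matrix.cons_val_two,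
      Matrix.tail_cons, Matrix.head_cons, Real.norm_eq_abs, sq_abs]
    have hsq : ((4 : ℝ) ^ (-(n : ℤ))) ^ 2 ≤ ((2 : ℝ) ^ (-(n : ℤ))) ^ 2 := pow_le_pow_left₀ h4.le h42 2
    nlinarith [hsq, sq_nonneg (fermiTangent μ θ₀ 0 * (dualPoint x₀ x) 1 + fermiTangent μ θ₀ 1 * (dualPoint x₀ x) 2)]
  calc ‖((x₀, x) : ℝ × (Fin 2 → ℝ))‖ ≤ 2 * π * (4 : ℝ) ^ n * ‖isoChartAdj μ θ₀ n (dualPoint x₀ x)‖ :=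
        norm_le_mul_norm_isoChartAdj hμ₁ hμ₂ θ₀ n x₀ x
    _ ≤ 2 * π * (4 : ℝ) ^ n * ‖sectorChartAdj μ θ₀ n (dualPoint x₀ x)‖ := mul_le_mul_of_nonneg_left hle (by positivity)

/-- **The moment bounds (2.52a)**: for every `j` there is `C_j` with `|x|^j g^{(h)}_ω ∈ L¹` and
`∫ |x|^j |g^{(-n)}_ω(x)| dx ≤ C_j 4^{n(1+j)}` (`= C_j γ^{-(1+j)h}`) for all `n` and all anisotropic sectors. [cite: BenfattoGiulianiMastropietro2006, §2.5 (2.52a)] -/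
theorem sectorPropagator_moment {e₀ : ℝ} (he : 0 < e₀) (he' : e₀ ≤ (4 + μ) / 2) (j : ℕ) :
    ∃ C : ℝ, 0 ≤ C ∧ ∀ (n : ℕ) (ω : ℕ), ω < sectorCount n →
      Integrable (fun p : ℝ × (Fin 2 → ℝ) => ‖p‖ ^ j * ‖sectorPropagator e₀ μ n ω p.1 p.2‖) ∧
        ∫ p : ℝ × (Fin 2 → ℝ), ‖p‖ ^ j * ‖sectorPropagator e₀ μ n ω p.1 p.2‖ ≤ C * ((4 : ℝ) ^ n) ^ (1 + j) := by
  obtain ⟨C₀, hC₀, hdec⟩ := sectorPropagator_decay hμ₁ hμ₂ he he' (j + 4)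
  set I : ℝ := ∫ u : MomSpace, ((1 + ‖u‖) ^ 4)⁻¹ with hI
  have hI0 : 0 ≤ I := integral_nonneg fun u => by positivity
  refine ⟨C₀ * (2 * π) ^ j * (2 * π) ^ 3 * I, by positivity, fun n ω hω => ?_⟩
  set θ₀ : ℝ := ((ω : ℝ) + 1 / 2) * sectorWidth n with hθ₀
  set W := sectorDualEquiv hμ₁ hμ₂ θ₀ n with hW
  set F : MomSpace → ℝ := fun u => ((1 + ‖u‖) ^ 4)⁻¹ with hF
  set g : ℝ × (Fin 2 → ℝ) → ℝ := fun p => ‖p‖ ^ j * ‖sectorPropagator e₀ μ n ω p.1 p.2‖ with hg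
  -- `‖p‖^j ‖g(p)‖ ≤ c F(S p)` with `c = C₀ (2π 4ⁿ)^j 4^{-n}2^{-n}`
  set c : ℝ := C₀ * (2 * π * (4 : ℝ) ^ n) ^ j * ((4 : ℝ) ^ (-(n : ℤ)) * (2 : ℝ) ^ (-(n : ℤ))) with hc
  have hc0 : 0 ≤ c := by positivity
  set b : ℝ × (Fin 2 → ℝ) → ℝ := fun p => c * F (sectorChartAdj μ θ₀ n (dualPoint p.1 p.2)) with hb
  have hgb : ∀ p, ‖g p‖ ≤ b p := fun p => by
    set a : ℝ := ‖sectorChartAdj μ θ₀ n (dualPoint p.1 p.2)‖ with ha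
    have ha0 : 0 ≤ a := norm_nonneg _
    have hdp := hdec n ω hω p.1 p.2
    rw [← hθ₀, ← ha] at hdp
    have hnorm : ‖p‖ ≤ 2 * π * (4 : ℝ) ^ n * a := by
      have := norm_le_mul_norm_sectorChartAdj hμ₁ hμ₂ θ₀ n p.1 p.2
      rwa [Prod.mk.eta] at this
    have hpj : ‖p‖ ^ j ≤ (2 * π * (4 : ℝ) ^ n) ^ j * a ^ j := by
      rw [← mul_pow]; exact pow_le_pow_left₀ (norm_nonneg _) hnorm j
    rw [hg, hb, hF]
    simp only [Real.norm_eq_abs, abs_mul, abs_pow, abs_norm]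
    calc ‖p‖ ^ j * ‖sectorPropagator e₀ μ n ω p.1 p.2‖
        ≤ ((2 * π * (4 : ℝ) ^ n) ^ j * a ^ j) * (C₀ * ((4 : ℝ) ^ (-(n : ℤ)) * (2 : ℝ) ^ (-(n : ℤ))) * ((1 + a) ^ (j + 4))⁻¹) :=
          mul_le_mul hpj hdp (norm_nonneg _) (by positivity)
      _ = c * (a ^ j * ((1 + a) ^ (j + 4))⁻¹) := by rw [hc]; ring
      _ ≤ c * ((1 + a) ^ 4)⁻¹ := mul_le_mul_of_nonneg_left (pow_mul_inv_pow_le ha0 j) hc0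
  -- `b ∘ splitMomentum = c • (F ∘ W)` and its integral (as in the `L¹` bound)
  have hbW : (b ∘ splitMomentum) = fun q => c * F (W q) := by
    funext q
    simp only [Function.comp_apply, hb, splitMomentum_apply, hW, sectorDualEquiv_apply]
  have hdetW : LinearMap.det ((W : MomSpace ≃ₗ[ℝ] MomSpace) : MomSpace →ₗ[ℝ] MomSpace) ≠ 0 := by
    rw [hW, det_sectorDualEquiv hμ₁ hμ₂]; positivity
  have hFW : Integrable (fun q => F (W q)) := by
    have hmap : Measure.map (W : MomSpace → MomSpace) volume =
        ENNReal.ofReal |(LinearMap.det ((W : MomSpace ≃ₗ[ℝ] MomSpace) : MomSpace →ₗ[ℝ] MomSpace))⁻¹| • volume :=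
      map_linearMap_addHaar_eq_smul_addHaar volume hdetW
    have h1 : Integrable F (Measure.map (W : MomSpace → MomSpace) volume) := by
      rw [hmap]; exact integrable_inv_one_add_norm_pow_four.smul_measure ENNReal.ofReal_ne_top
    exact (integrable_map_equiv W.toHomeomorph.toMeasurableEquiv F).1 h1
  have hintFW : ∫ q, F (W q) = (2 * π) ^ 3 * ((4 : ℝ) ^ n * (4 : ℝ) ^ n * (2 : ℝ) ^ n) * I := by
    rw [integral_comp_continuousLinearEquiv volume W F, det_sectorDualEquiv hμ₁ hμ₂, smul_eq_mul, ← hI]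
    congr 1
    rw [abs_of_pos (by positivity), inv_div, zpow_neg, zpow_neg, zpow_natCast, zpow_natCast]
    field_simp
  have hbi : Integrable b := by
    rw [← measurePreserving_splitMomentum.integrable_comp_emb splitMomentum.measurableEmbedding, hbW]
    exact hFW.const_mul c
  have hbint : ∫ p, b p = C₀ * (2 * π) ^ j * (2 * π) ^ 3 * I * ((4 : ℝ) ^ n) ^ (1 + j) := by
    rw [← measurePreserving_splitMomentum.integral_comp splitMomentum.measurableEmbedding]
    change ∫ q, (b ∘ splitMomentum) q = _
    rw [hbW, integral_const_mul, hintFW, hc]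
    have h4 : (4 : ℝ) ^ (-(n : ℤ)) * (4 : ℝ) ^ n = 1 := by rw [zpow_neg, zpow_natCast, inv_mul_cancel₀ (by positivity)]
    have h2 : (2 : ℝ) ^ (-(n : ℤ)) * (2 : ℝ) ^ n = 1 := by rw [zpow_neg, zpow_natCast, inv_mul_cancel₀ (by positivity)]
    rw [pow_add, pow_one, mul_pow]
    linear_combination (C₀ * (2 * π) ^ j * ((4 : ℝ) ^ n) ^ j * (2 * π) ^ 3 * I * (4 : ℝ) ^ n *
      ((2 : ℝ) ^ (-(n : ℤ)) * (2 : ℝ) ^ n)) * h4 +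
      (C₀ * (2 * π) ^ j * ((4 : ℝ) ^ n) ^ j * (2 * π) ^ 3 * I * (4 : ℝ) ^ n) * h2
  -- conclude
  have hgm : AEStronglyMeasurable g volume :=
    ((continuous_norm.pow j).mul (continuous_sectorPropagator hμ₁ hμ₂ he he' n ω).norm).aestronglyMeasurable
  have hgi : Integrable g := Integrable.mono' hbi hgm (ae_of_all _ hgb)
  refine ⟨hgi, ?_⟩
  have hgg : ∀ p, g p ≤ b p := fun p => le_trans (le_abs_self _) (by simpa [Real.norm_eq_abs] using hgb p)
  calc ∫ p, g p ≤ ∫ p, b p := integral_mono hgi hbi hgg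
    _ = C₀ * (2 * π) ^ j * (2 * π) ^ 3 * I * ((4 : ℝ) ^ n) ^ (1 + j) := hbint

end Moments

end Literature.MathematicalPhysics.QuantumLattice

end
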